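import Literature.NumberTheory.LFunctions.Zhang2022.Section7TailP2Aux
import Literature.NumberTheory.LFunctions.Zhang2022.Section7DeltaFar
import HarnessLib

/-!
# Zhang (2022) §7, proof of Proposition 7.1 (b): the `l ∉ 𝔌(Rh)` truncation `𝔰 ↦ 𝔰*` (Z22:§7.u037)

Cell `siegel-zhang` (D-0069 width campaign), layer L2, seat sz-d26. DAG node `Z22:§7.u037`
[Z22 p.38, tex L2036]: "By Lemma 5.1, for `R ≤ r < 2R`, the terms with `l ∉ 𝔌(Rh)` in
`𝔰(r,h,d;θ)` make a negligible contribution", typed as `Section7cStatements.Step7bTruncI c′`: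
`|𝔰(r,h,d;θ) − 𝔰*(R,r,h,d;θ)| ≤ exp(−c𝓛¹⁰)` under the ranges (7.15) (`dh < P₁`,
`D ≤ R < P₁/(dh)`), `θ` primitive. Y. Zhang, arXiv:2211.02515v1 [Zhang2022LandauSiegel], an
unrefereed manuscript under adjudication; WHAT THIS IS NOT: any claim about its Theorems 1–2 or
about Landau–Siegel zeros.

## Proof

The window `p ∼ P` is `P < p < P(1 + 𝓛⁻⁶⁸)` and `R ≤ r < 2R`, so for `l ∉ 𝔌(Rh) =
[(1/3)Pt₀Rh, 4Pt₀Rh]` the argument `x = l/(phr)` of `Δ` satisfies `x < t₀/3` or `x > (9/5)t₀`,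
hence `|x − t₀| ≥ (3/5)t₀` (`far_of_not_mem_natI`). There `‖Δ(x)‖ ≤ e^{−c𝓛¹⁰}x⁻⁶`
(`DeltaFar.norm_DeltaW_le_of_far`, from Lemma 5.3 — the manuscript's "Lemma 5.1" names the
`Δ`-localisation of Lemma 5.3). With `|(κ∗𝐚₁)(dl)| ≤ Bτ(dl)⁴ ≤ B(dl)⁴`
(`Section7TailP2.norm_conv_kappa_le`), `|θ| ≤ 1`, `|p^{β₃}| = 1` (`Re β₃ = 0`), `#{p ∼ P} ≤ 3P`
and `x⁻⁶ ≤ (4PhR)⁶l⁻⁶`, the `l`-th discarded term is `≤ 12288·B·P¹⁷e^{−c𝓛¹⁰}·l⁻²`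
(`d, hR ≤ P₁ ≤ P`), and `Σ l⁻² < ∞`; the factor `P¹⁷ = e^{17𝓛⁹}` is absorbed into
`e^{−(c/2)𝓛¹⁰}` for `𝓛` large.

Main result: `step7bTruncI_holds (c′) : Section7cStatements.Step7bTruncI c′` (unconditional; the
antecedent (A) is not used).

[cite: Zhang2022LandauSiegel, §7 p.38 (tex L2036); §5 Lemma 5.3 (5.8)–(5.9)]
-/

noncomputable section

open Complex Real Finset

namespace Literature.NumberTheory.LFunctions.Zhang2022.Section7TruncI

open Literature.NumberTheory.LFunctions.Zhang2022.Skeleton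
open Literature.NumberTheory.LFunctions.Zhang2022.Section7cStatements

/-! ### A generic tail estimate -/

/-- If `f = Σ' F`, `f* = Σ_{l∈S} F` and `‖F l‖ ≤ g l` off `S` with `g ≥ 0` summable, then
`‖f − f*‖ ≤ Σ' g`. [folklore] -/
private theorem norm_sub_le_of_tsum {f fstar : ℂ} {F : ℕ → ℂ} {g : ℕ → ℝ} (S : Finset ℕ)
    (hf : f = ∑' l, F l) (hfstar : fstar = ∑ l ∈ S, F l) (hg : Summable g)
    (hg0 : ∀ l, 0 ≤ g l) (hFg : ∀ l, l ∉ S → ‖F l‖ ≤ g l) : ‖f - fstar‖ ≤ ∑' l, g l := by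
  classical
  set U : ℕ → ℂ := fun l => if l ∈ S then 0 else F l with hU
  set V : ℕ → ℂ := fun l => if l ∈ S then F l else 0 with hV
  have hUg : ∀ l, ‖U l‖ ≤ g l := fun l => by
    by_cases hl : l ∈ S
    · simp only [hU, if_pos hl, norm_zero]; exact hg0 l
    · simp only [hU, if_neg hl]; exact hFg l hl
  have hUs : Summable U := Summable.of_norm_bounded hg hUg
  have hVs : Summable V :=
    summable_of_ne_finset_zero (s := S) (fun l hl => by simp only [hV, if_neg hl])
  have hVsum : ∑' l, V l = ∑ l ∈ S, F l := by
    rw [tsum_eq_sum (s := S) (fun l hl => by simp only [hV, if_neg hl])]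
    exact Finset.sum_congr rfl fun l hl => by simp only [hV, if_pos hl]
  have htsum : ∑' l, F l = ∑' l, (V l + U l) :=
    tsum_congr fun l => by by_cases hl : l ∈ S <;> simp [hU, hV, hl]
  rw [hf, hfstar, htsum, hVs.tsum_add hUs, hVsum, add_sub_cancel_left]
  exact tsum_of_norm_bounded hg.hasSum hUg

/-! ### Geometry of the window: `l ∉ 𝔌(Rh)` puts `l/(phr)` far from `t₀` -/

/-- For `l ≥ 1` with `l ∉ 𝔌(Rh)`, `p ∼ P` (`P < p < P(1+𝓛⁻⁶⁸)`) and `R ≤ r < 2R`, the point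
`x = l/(phr)` satisfies `x < t₀/3` or `x > (9/5)t₀`, hence `|x − t₀| ≥ (3/5)t₀`.
[cite: Zhang2022LandauSiegel, §7 p.38 (tex L2033–L2036)] -/
theorem far_of_not_mem_natI {D : ℕ} (hℓ : 2 ≤ ell D) {R : ℝ} {h r p l : ℕ} (hR : 0 < R)
    (hh : 0 < h) (hrR : R ≤ (r : ℝ)) (hr2 : (r : ℝ) < 2 * R) (hp : p ∈ primeWindow D)
    (hl : 0 < l) (hlS : l ∉ natI D (R * h)) :
    3 / 5 * t0 D ≤ |(l : ℝ) / ((p : ℝ) * h * r) - t0 D| := by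
  classical
  have hP := bigP_pos D
  have hPp := bigP_lt_of_mem_primeWindow hp
  have hp2 := lt_of_mem_primeWindow hp
  have hℓ0 : 0 < ell D := by linarith
  have ht0 : 0 < t0 D := by rw [t0]; exact pow_pos hℓ0 519
  have hh0 : (0 : ℝ) < h := Nat.cast_pos.mpr hh
  have hr0 : (0 : ℝ) < r := lt_of_lt_of_le hR hrR
  have hp0 : (0 : ℝ) < p := pos_of_mem_primeWindow hp
  set Q : ℝ := (p : ℝ) * h * r with hQ
  have hQpos : 0 < Q := by positivity
  have hQlow : bigP D * h * R ≤ Q := by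
    have h1 : bigP D * h ≤ (p : ℝ) * h := mul_le_mul_of_nonneg_right hPp.le hh0.le
    exact mul_le_mul h1 hrR hR.le (by positivity)
  have hinv : (ell D ^ 68)⁻¹ ≤ (9 : ℝ)⁻¹ := by
    apply inv_anti₀ (by norm_num)
    have h68 : (2 : ℝ) ^ 68 ≤ ell D ^ 68 := pow_le_pow_left₀ (by norm_num) hℓ 68
    linarith [show (9 : ℝ) ≤ 2 ^ 68 by norm_num]
  have hp109 : (p : ℝ) ≤ 10 / 9 * bigP D := by
    have h1 : bigP D * (1 + (ell D ^ 68)⁻¹) ≤ bigP D * (1 + 9⁻¹) := by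
      apply mul_le_mul_of_nonneg_left _ hP.le; linarith
    linarith
  have hQup : Q < 20 / 9 * (bigP D * h * R) := by
    have h1 : (p : ℝ) * h ≤ 10 / 9 * bigP D * h := mul_le_mul_of_nonneg_right hp109 hh0.le
    have h2 : (p : ℝ) * h * r < 10 / 9 * bigP D * h * (2 * R) :=
      mul_lt_mul' h1 hr2 hr0.le (by positivity)
    calc Q = (p : ℝ) * h * r := rfl
      _ < 10 / 9 * bigP D * h * (2 * R) := h2
      _ = 20 / 9 * (bigP D * h * R) := by ring
  -- `l ∉ 𝔌(Rh)` as a real-number statement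
  have hnot : ¬ (1 / 3 * bigP D * t0 D * (R * h) ≤ (l : ℝ) ∧
      (l : ℝ) ≤ 4 * bigP D * t0 D * (R * h)) := by
    intro hmem
    apply hlS
    rw [natI, Finset.mem_filter, Finset.mem_range]
    refine ⟨?_, hl, hmem.1, hmem.2⟩
    have : l ≤ ⌊4 * bigP D * t0 D * (R * h)⌋₊ := Nat.le_floor hmem.2
    omega
  rw [not_and_or, not_le, not_le] at hnot
  rcases hnot with hlow | hhigh
  · -- `l < (1/3)Pt₀Rh ⇒ x < t₀/3`
    have hx : (l : ℝ) / Q < t0 D / 3 := by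
      rw [div_lt_iff₀ hQpos]
      calc (l : ℝ) < 1 / 3 * bigP D * t0 D * (R * h) := hlow
        _ = t0 D / 3 * (bigP D * h * R) := by ring
        _ ≤ t0 D / 3 * Q := mul_le_mul_of_nonneg_left hQlow (by positivity)
    rw [abs_sub_comm, abs_of_nonneg (by linarith)]
    linarith
  · -- `l > 4Pt₀Rh ⇒ x > (9/5)t₀`
    have hx : 9 / 5 * t0 D < (l : ℝ) / Q := by
      rw [lt_div_iff₀ hQpos]
      calc 9 / 5 * t0 D * Q < 9 / 5 * t0 D * (20 / 9 * (bigP D * h * R)) :=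
            mul_lt_mul_of_pos_left hQup (by positivity)
        _ = 4 * bigP D * t0 D * (R * h) := by ring
        _ < l := hhigh
    rw [abs_of_nonneg (by linarith)]
    linarith

/-! ### The truncation `𝔰 ↦ 𝔰*` -/

/-- `Re β₃ = 0` (`β₃ = 3iα(1 − c′α𝓛)` (2.13)), so `|p^{β₃}| = 1`.
[cite: Zhang2022LandauSiegel, §2 (2.13)] -/
private theorem beta3_re (c' : ℝ) (D : ℕ) : (beta3 c' D).re = 0 := by
  rw [beta3_eq_mul_I, Complex.re_ofReal_mul, Complex.I_re, mul_zero]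

/-- **Z22:§7.u037** [Z22 p.38, tex L2036] DISCHARGED: `Section7cStatements.Step7bTruncI c′` — for
all large `D`, `𝐚₁` admissible (7.2), `dh < P₁`, `D ≤ R < P₁/(dh)`, `R ≤ r < 2R`, `θ (mod r)`:
`|𝔰(r,h,d;θ) − 𝔰*(R,r,h,d;θ)| ≤ exp(−c𝓛¹⁰)` (with `c` = half the constant of
`DeltaFar.norm_DeltaW_le_of_far`; the hypotheses (A) and "`θ` primitive" are not needed).
[cite: Zhang2022LandauSiegel, §7 p.38 (tex L2036); §5 Lemma 5.3] -/
theorem step7bTruncI_holds (c' : ℝ) : Step7bTruncI c' := by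
  classical
  intro B
  obtain ⟨c₀, hc₀, D₁, hfar⟩ := DeltaFar.norm_DeltaW_le_of_far
  -- `Z = Σ_l l⁻²`
  have hZsum : Summable (fun l : ℕ => ((l : ℝ) ^ 2)⁻¹) :=
    Real.summable_nat_pow_inv.mpr one_lt_two
  set Z : ℝ := ∑' l : ℕ, ((l : ℝ) ^ 2)⁻¹ with hZ
  have hZ0 : 0 ≤ Z := tsum_nonneg fun l => by positivity
  set B₀ : ℝ := max B 0 with hB₀
  have hB₀0 : 0 ≤ B₀ := le_max_right _ _
  have hBB₀ : B ≤ B₀ := le_max_left _ _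
  set K : ℝ := 12288 * B₀ * Z with hK
  have hK0 : 0 ≤ K := by positivity
  set M : ℝ := max 2 (2 / c₀ * (17 + Real.log (K + 1))) with hM
  obtain ⟨D₂, hD₂⟩ := exists_nat_forall_le_ell M
  refine ⟨c₀ / 2, by positivity, max D₁ D₂, ?_⟩
  intro D _ χ hD hq hprim _hA a₁ ha d h R hd hh hIR r hr θ _hθ
  have hD₁ : D₁ ≤ D := le_trans (le_max_left _ _) hD
  have hMℓ : M ≤ ell D := hD₂ D (le_trans (le_max_right _ _) hD)
  have hℓ2 : 2 ≤ ell D := le_trans (le_max_left _ _) hMℓ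
  have hℓM : 2 / c₀ * (17 + Real.log (K + 1)) ≤ ell D := le_trans (le_max_right _ _) hMℓ
  have hℓ1 : 1 ≤ ell D := by linarith
  have hℓ0 : 0 < ell D := by linarith
  have hfarD := hfar D χ hD₁ hq hprim
  obtain ⟨ha1, -⟩ := ha
  have hB0 : 0 ≤ B := (norm_nonneg _).trans (ha1 0)
  -- the ranges
  obtain ⟨hdh, hDR, hRup⟩ := hIR
  have hD1 : (1 : ℝ) ≤ D := by exact_mod_cast Nat.one_le_iff_ne_zero.mpr (NeZero.ne D)
  have hR0 : 0 < R := by linarith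
  obtain ⟨hrR, hr2⟩ := (Finset.mem_filter.mp hr).2
  have hh0 : (0 : ℝ) < h := Nat.cast_pos.mpr hh
  have hd0 : (0 : ℝ) < d := Nat.cast_pos.mpr hd
  have hr0 : (0 : ℝ) < r := lt_of_lt_of_le hR0 hrR
  have hP := bigP_pos D
  have hP1 : 1 ≤ bigP D := by rw [bigP]; exact Real.one_le_exp (by positivity)
  have hP1P : Skeleton.P1 D ≤ bigP D := by
    rw [Skeleton.P1]
    calc bigP D ^ (0.504 : ℝ) ≤ bigP D ^ (1 : ℝ) :=
          Real.rpow_le_rpow_of_exponent_le hP1 (by norm_num)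
      _ = bigP D := Real.rpow_one _
  have hP10 : 0 ≤ Skeleton.P1 D := by rw [Skeleton.P1]; exact Real.rpow_nonneg hP.le _
  have hd_le : (d : ℝ) ≤ bigP D := by
    have : (d : ℝ) ≤ ((d * h : ℕ) : ℝ) := by exact_mod_cast Nat.le_mul_of_pos_right d hh
    linarith
  have hhR_le : (h : ℝ) * R ≤ bigP D := by
    have e1 : (h : ℝ) * (Skeleton.P1 D / ((d * h : ℕ) : ℝ)) = Skeleton.P1 D / d := by
      push_cast; field_simp
    have h1 : (h : ℝ) * R ≤ (h : ℝ) * (Skeleton.P1 D / ((d * h : ℕ) : ℝ)) :=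
      mul_le_mul_of_nonneg_left hRup.le hh0.le
    have h2 : Skeleton.P1 D / d ≤ Skeleton.P1 D := div_le_self hP10 (Nat.one_le_cast.mpr hd)
    linarith [e1]
  -- the parameters of the majorant
  set ε : ℝ := Real.exp (-c₀ * ell D ^ 10) with hε
  have hε0 : 0 < ε := Real.exp_pos _
  set W : ℝ := 4 * bigP D * h * R with hW
  have hW0 : 0 ≤ W := by positivity
  have hW_le : W ≤ 4 * bigP D ^ 2 := by
    calc W = 4 * bigP D * ((h : ℝ) * R) := by rw [hW]; ring
      _ ≤ 4 * bigP D * bigP D := mul_le_mul_of_nonneg_left hhR_le (by positivity)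
      _ = 4 * bigP D ^ 2 := by ring
  set A : ℝ := B * (d : ℝ) ^ 4 * (3 * bigP D) * W ^ 6 * ε with hA
  have hA0 : 0 ≤ A :=
    mul_nonneg (mul_nonneg (mul_nonneg (mul_nonneg hB0 (pow_nonneg hd0.le 4)) (by positivity))
      (pow_nonneg hW0 6)) hε0.le
  set S : Finset ℕ := natI D (R * h) with hS
  -- reduce to the termwise bound off `S`
  have hgsum : Summable (fun l : ℕ => A * ((l : ℝ) ^ 2)⁻¹) := hZsum.mul_left A
  have hg0 : ∀ l : ℕ, 0 ≤ A * ((l : ℝ) ^ 2)⁻¹ := fun l => by positivity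
  refine (norm_sub_le_of_tsum S
    (F := fun l => if Nat.Coprime l h then
      MeanSquareMajorant.conv (kappaZ c' D) a₁ (d * l) * θ (l : ZMod r) *
        ∑ p ∈ primeWindow D, (p : ℂ) ^ beta3 c' D * θ⁻¹ (p : ZMod r) *
          DeltaW D ((l : ℝ) / ((p : ℝ) * h * r))
      else 0)
    rfl ?_ hgsum hg0 ?_).trans ?_
  · -- `𝔰* = Σ_{l ∈ S} F l`
    rw [frakSstar, Finset.sum_filter]
    refine Finset.sum_congr rfl fun l _ => ?_
    split_ifs with hc
    · congr 1
      exact Finset.sum_congr rfl fun p _ => by ring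
    · rfl
  · -- termwise bound off `S`
    intro l hlS
    rcases Nat.eq_zero_or_pos l with rfl | hl
    · have h0 : MeanSquareMajorant.conv (kappaZ c' D) a₁ 0 = 0 := by
        have := Section7TailP2.norm_conv_kappa_le c' D ha1 (d * 0)
        rw [mul_zero, Nat.divisors_zero, Finset.card_empty] at this
        simpa using this
      simp [h0]
    by_cases hc : Nat.Coprime l h
    swap
    · rw [if_neg hc, norm_zero]; exact hg0 l
    rw [if_pos hc]
    have hl0 : (0 : ℝ) < l := Nat.cast_pos.mpr hl
    -- the coefficient
    have hconv : ‖MeanSquareMajorant.conv (kappaZ c' D) a₁ (d * l)‖ ≤ B * ((d * l : ℕ) : ℝ) ^ 4 :=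
      (Section7TailP2.norm_conv_kappa_le c' D ha1 (d * l)).trans
        (mul_le_mul_of_nonneg_left (pow_le_pow_left₀ (Nat.cast_nonneg _)
          (by exact_mod_cast Nat.card_divisors_le_self (d * l)) 4) hB0)
    -- the `p`-sum
    have hinner : ‖∑ p ∈ primeWindow D, (p : ℂ) ^ beta3 c' D * θ⁻¹ (p : ZMod r) *
        DeltaW D ((l : ℝ) / ((p : ℝ) * h * r))‖ ≤ 3 * bigP D * (ε * (W / l) ^ 6) := by
      calc ‖∑ p ∈ primeWindow D, (p : ℂ) ^ beta3 c' D * θ⁻¹ (p : ZMod r) *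
              DeltaW D ((l : ℝ) / ((p : ℝ) * h * r))‖
          ≤ ∑ p ∈ primeWindow D, ‖(p : ℂ) ^ beta3 c' D * θ⁻¹ (p : ZMod r) *
              DeltaW D ((l : ℝ) / ((p : ℝ) * h * r))‖ := norm_sum_le _ _
        _ ≤ ∑ p ∈ primeWindow D, ε * (W / l) ^ 6 := by
            refine Finset.sum_le_sum fun p hp => ?_
            have hp0 : (0 : ℝ) < p := pos_of_mem_primeWindow hp
            have hQ0 : 0 < (p : ℝ) * h * r := by positivity
            have hx0 : 0 < (l : ℝ) / ((p : ℝ) * h * r) := div_pos hl0 hQ0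
            have hΔ := hfarD ((l : ℝ) / ((p : ℝ) * h * r)) hx0
              (far_of_not_mem_natI hℓ2 hR0 hh hrR hr2 hp hl hlS)
            have hQW : (p : ℝ) * h * r ≤ W := by
              calc (p : ℝ) * h * r ≤ 2 * bigP D * h * (2 * R) :=
                    mul_le_mul (mul_le_mul_of_nonneg_right
                      (le_two_mul_bigP_of_mem_primeWindow hℓ1 hp) hh0.le) hr2.le hr0.le
                      (by positivity)
                _ = W := by rw [hW]; ring
            have hx6 : (((l : ℝ) / ((p : ℝ) * h * r)) ^ 6)⁻¹ ≤ (W / l) ^ 6 := by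
              rw [← inv_pow, inv_div]
              exact pow_le_pow_left₀ (div_nonneg hQ0.le hl0.le)
                (div_le_div_of_nonneg_right hQW hl0.le) 6
            rw [norm_mul, norm_mul,
              Complex.norm_natCast_cpow_of_pos (prime_of_mem_primeWindow' hp).pos, beta3_re,
              Real.rpow_zero, one_mul]
            calc ‖θ⁻¹ (p : ZMod r)‖ * ‖DeltaW D ((l : ℝ) / ((p : ℝ) * h * r))‖
                ≤ 1 * (ε * (((l : ℝ) / ((p : ℝ) * h * r)) ^ 6)⁻¹) :=
                  mul_le_mul (DirichletCharacter.norm_le_one _ _) hΔ (norm_nonneg _) zero_le_one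
              _ ≤ ε * (W / l) ^ 6 := by
                  rw [one_mul]; exact mul_le_mul_of_nonneg_left hx6 hε0.le
        _ = ((primeWindow D).card : ℝ) * (ε * (W / l) ^ 6) := by
            rw [Finset.sum_const, nsmul_eq_mul]
        _ ≤ 3 * bigP D * (ε * (W / l) ^ 6) :=
            mul_le_mul_of_nonneg_right (Section7TailP2.card_primeWindow_le hℓ1) (by positivity)
    have hBdl : 0 ≤ B * ((d * l : ℕ) : ℝ) ^ 4 := mul_nonneg hB0 (pow_nonneg (Nat.cast_nonneg _) 4)
    calc ‖MeanSquareMajorant.conv (kappaZ c' D) a₁ (d * l) * θ (l : ZMod r) *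
            ∑ p ∈ primeWindow D, (p : ℂ) ^ beta3 c' D * θ⁻¹ (p : ZMod r) *
              DeltaW D ((l : ℝ) / ((p : ℝ) * h * r))‖
        = ‖MeanSquareMajorant.conv (kappaZ c' D) a₁ (d * l)‖ * ‖θ (l : ZMod r)‖ *
            ‖∑ p ∈ primeWindow D, (p : ℂ) ^ beta3 c' D * θ⁻¹ (p : ZMod r) *
              DeltaW D ((l : ℝ) / ((p : ℝ) * h * r))‖ := by rw [norm_mul, norm_mul]
      _ ≤ B * ((d * l : ℕ) : ℝ) ^ 4 * 1 * (3 * bigP D * (ε * (W / l) ^ 6)) :=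
          mul_le_mul (mul_le_mul hconv (DirichletCharacter.norm_le_one _ _) (norm_nonneg _) hBdl)
            hinner (norm_nonneg _) (by rw [mul_one]; exact hBdl)
      _ = A * ((l : ℝ) ^ 2)⁻¹ := by
          rw [hA]
          have hl0' : (l : ℝ) ≠ 0 := hl0.ne'
          push_cast
          field_simp
          try ring
  · -- `Σ' g = A·Z ≤ exp(−(c₀/2)𝓛¹⁰)`
    rw [tsum_mul_left]
    have hA_le : A ≤ 12288 * B₀ * bigP D ^ 17 * ε := by
      have h1 : (d : ℝ) ^ 4 ≤ bigP D ^ 4 := pow_le_pow_left₀ hd0.le hd_le 4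
      have h2 : W ^ 6 ≤ (4 * bigP D ^ 2) ^ 6 := pow_le_pow_left₀ hW0 hW_le 6
      have h3 : B * (d : ℝ) ^ 4 ≤ B₀ * bigP D ^ 4 := mul_le_mul hBB₀ h1 (by positivity) hB₀0
      calc A = B * (d : ℝ) ^ 4 * (3 * bigP D) * W ^ 6 * ε := rfl
        _ ≤ B₀ * bigP D ^ 4 * (3 * bigP D) * (4 * bigP D ^ 2) ^ 6 * ε := by
            apply mul_le_mul_of_nonneg_right _ hε0.le
            exact mul_le_mul (mul_le_mul_of_nonneg_right h3 (by positivity)) h2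
              (pow_nonneg hW0 6) (by positivity)
        _ = 12288 * B₀ * bigP D ^ 17 * ε := by ring
    have hP17 : bigP D ^ 17 = Real.exp (17 * ell D ^ 9) := by
      rw [bigP, ← Real.exp_nat_mul]; norm_num
    have hK1 : 0 < K + 1 := by linarith
    have hKexp : K ≤ Real.exp (Real.log (K + 1)) := by
      rw [Real.exp_log hK1]; linarith
    have hlogK : 0 ≤ Real.log (K + 1) := Real.log_nonneg (by linarith)
    have hℓ9 : 1 ≤ ell D ^ 9 := one_le_pow₀ hℓ1
    have h1 : 17 + Real.log (K + 1) ≤ c₀ / 2 * ell D := by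
      have h := mul_le_mul_of_nonneg_left hℓM (by positivity : (0 : ℝ) ≤ c₀ / 2)
      have e : c₀ / 2 * (2 / c₀ * (17 + Real.log (K + 1))) = 17 + Real.log (K + 1) := by
        field_simp
      linarith [e]
    have h2 : Real.log (K + 1) + 17 * ell D ^ 9 ≤ c₀ / 2 * ell D ^ 10 := by
      calc Real.log (K + 1) + 17 * ell D ^ 9 ≤ (17 + Real.log (K + 1)) * ell D ^ 9 := by
            nlinarith
        _ ≤ c₀ / 2 * ell D * ell D ^ 9 := mul_le_mul_of_nonneg_right h1 (by positivity)
        _ = c₀ / 2 * ell D ^ 10 := by ring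
    calc A * Z ≤ 12288 * B₀ * bigP D ^ 17 * ε * Z := mul_le_mul_of_nonneg_right hA_le hZ0
      _ = K * bigP D ^ 17 * ε := by rw [hK]; ring
      _ ≤ Real.exp (Real.log (K + 1)) * bigP D ^ 17 * ε := by
          apply mul_le_mul_of_nonneg_right _ hε0.le
          exact mul_le_mul_of_nonneg_right hKexp (by positivity)
      _ = Real.exp (Real.log (K + 1) + 17 * ell D ^ 9 + -c₀ * ell D ^ 10) := by
          rw [hP17, hε, Real.exp_add, Real.exp_add]
      _ ≤ Real.exp (-(c₀ / 2) * ell D ^ 10) := Real.exp_le_exp.mpr (by linarith)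

end Literature.NumberTheory.LFunctions.Zhang2022.Section7TruncI
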